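import Literature.NumberTheory.Sieve.SmoothTwistedSaddle
import HarnessLib

/-!
# The twisted saddle point in the range `(log x)^4 ≤ y ≤ exp((log x)^{1/5})`

Topic `Literature/NumberTheory/Sieve`; a PROVED file toward
`Literature.NumberTheory.DiophantineGeometry.XYZUpperHalf` ([Harper2016, Cor. 1], smoothed major
arc `q = 1`). We verify the hypotheses of `TwistedWeight.norm_twistedSum_sub_main_le_param` in the
range `(log x)^4 ≤ y ≤ exp((log x)^{1/5})` (`twist_range`: the window `τ = 100/√φ₂`, the decay of
`ζ(α+it, y)/ζ(α, y)` from Chebyshev / Brun–Titchmarsh), and deduce the major-arc asymptotic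

`scaledSum_main_term`: for every `ε > 0`, all large `x`, `(log x)^4 ≤ y ≤ exp((log x)^{1/5})`,
`1 ≤ Λ`, `Λ⁸ ≤ y`, `1 ≤ e ≤ (log x)^{100}` and `|λ| ≤ Λ`:
`‖∑_{n ∈ S(x/e, y)} W_λ(n/(x/e)) − e^{−α} 𝓜 Ŵ_λ(α)‖ ≤ e^{−α}(ε + e^{−66}) 𝓜/(1 + |λ|)`,
`𝓜 = x^α ζ(α,y)/√(2π φ₂(α,y))`, `α = α(x, y)` (the SAME saddle point for all scales `x/e`);
`twistedSum_main_term` is the case `e = 1`.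

## References

* A. J. Harper, Compositio Math. 152 (2016), §5 [Harper2016].
* A. Hildebrand, G. Tenenbaum, Trans. AMS 296 (1986), §4 [HildebrandTenenbaum1986].
-/

noncomputable section

open Real Complex MeasureTheory Set Filter
open scoped FourierTransform Topology

namespace Literature.NumberTheory.Sieve

namespace TwistedWeight

set_option maxHeartbeats 1600000 in
/-- **The range lemma.** In the range `x ≥ x₀`, `(log x)^4 ≤ y ≤ exp((log x)^{1/5})`: `α = α(x,y) ∈ [3/5,1]`,
`c (log x)(log y) ≤ φ₂ ≤ 3 (log x)(log y)`, the window `τ = 100/√φ₂` satisfies `τ ≤ π/log y ≤ 1` and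
`13τ³ log y φ₂ ≤ 1`, and `ζ(α+it,y)/ζ(α,y) ≤ exp(−A₂ (log x)^{1/5})` for `π/log y ≤ |t| ≤ 3`,
`≤ exp(−A₃ (log x)^{3/5})` for `3 ≤ |t| ≤ κ √y` (and `κ√y ≥ 3`).
[cite: HildebrandTenenbaum1986, §4 (Lemmas 8, 10)] -/
theorem twist_range :
    ∃ A₂ A₃ κ c : ℝ, 0 < A₂ ∧ 0 < A₃ ∧ 0 < κ ∧ 0 < c ∧ ∃ x₀ : ℝ, ∀ (x : ℝ) (y : ℕ), x₀ ≤ x →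
      Real.log x ^ 4 ≤ y → Real.log y ≤ Real.log x ^ (1 / 5 : ℝ) →
      1 < x ∧ 2 ≤ y ∧ 3 / 5 ≤ saddlePoint x y ∧ saddlePoint x y ≤ 1 ∧
      0 < saddlePhi₂ (saddlePoint x y) y ∧
      c * (Real.log x * Real.log y) ≤ saddlePhi₂ (saddlePoint x y) y ∧
      saddlePhi₂ (saddlePoint x y) y ≤ 3 * Real.log x * Real.log y ∧
      16 ≤ Real.log x ∧ 11 ≤ Real.log y ∧
      100 / Real.sqrt (saddlePhi₂ (saddlePoint x y) y) ≤ Real.pi / Real.log y ∧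
      Real.pi / Real.log y ≤ 1 ∧
      13 * (100 / Real.sqrt (saddlePhi₂ (saddlePoint x y) y)) ^ 3 * Real.log y *
        saddlePhi₂ (saddlePoint x y) y ≤ 1 ∧
      (∀ t : ℝ, Real.pi / Real.log y ≤ |t| → |t| ≤ 3 →
        ‖smoothZetaC ((saddlePoint x y : ℂ) + t * I) y‖ / smoothZeta (saddlePoint x y) y ≤
          Real.exp (-(A₂ * Real.log x ^ (1 / 5 : ℝ)))) ∧
      3 ≤ κ * (y : ℝ) ^ (1 / 2 : ℝ) ∧
      (∀ t : ℝ, 3 ≤ |t| → |t| ≤ κ * (y : ℝ) ^ (1 / 2 : ℝ) →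
        ‖smoothZetaC ((saddlePoint x y : ℂ) + t * I) y‖ / smoothZeta (saddlePoint x y) y ≤
          Real.exp (-(A₃ * (Real.log x ^ (1 / 5 : ℝ)) ^ 3))) := by
  classical
  -- ### constants from the tree
  obtain ⟨c_B, x_B, hc_B, hB⟩ := le_rpow_one_sub_saddlePoint
  obtain ⟨x₃, h35⟩ := three_fifths_le_saddlePoint
  obtain ⟨c_φ, x_φ, hc_φ, hφlo⟩ := le_saddlePhi₂_saddlePoint
  obtain ⟨x_φ', hφhi⟩ := saddlePhi₂_saddlePoint_le
  obtain ⟨c₂, hc₂, y₂, h2⟩ := exists_decaySum_ge_sqrt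
  obtain ⟨c₃, hc₃, κ, hκ, y₃, h3⟩ := exists_decaySum_ge_linear
  set A₂ : ℝ := c₂ * Real.sqrt c_B / 25 with hA₂
  set A₃ : ℝ := c₃ * c_B / 25 with hA₃
  have hsqrtcB : 0 < Real.sqrt c_B := Real.sqrt_pos.2 hc_B
  have hA₂0 : 0 < A₂ := by positivity
  have hA₃0 : 0 < A₃ := by positivity
  set u₀ : ℝ := max (max 2 (1 / (c_B * Real.log 2) + 1)) (max (10 ^ 4 / (9 * c_φ)) (169 * 10 ^ 12 / c_φ)) with hu₀
  have hu₀2 : 2 ≤ u₀ := le_trans (le_max_left _ _) (le_max_left _ _)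
  have hu₀1 : 1 ≤ u₀ := by linarith only [hu₀2]
  set L₀ : ℝ := max (max (max 16 ((y₂ : ℝ) + y₃)) (max (10 ^ 6 / c_φ) (3 / κ))) (u₀ ^ 2) with hL₀
  have hL₀16 : 16 ≤ L₀ := le_trans (le_trans (le_max_left _ _) (le_max_left _ _)) (le_max_left _ _)
  refine ⟨A₂, A₃, κ, c_φ, hA₂0, hA₃0, hκ, hc_φ, max (max (max x_B x₃) (max x_φ x_φ')) (Real.exp L₀),
    fun x y hx hy4 hylog => ?_⟩
  -- ### the range
  have hxB : x_B ≤ x := le_trans (le_trans (le_max_left _ _) (le_max_left _ _)) (le_trans (le_max_left _ _) hx)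
  have hx₃ : x₃ ≤ x := le_trans (le_trans (le_max_right _ _) (le_max_left _ _)) (le_trans (le_max_left _ _) hx)
  have hxφ : x_φ ≤ x := le_trans (le_trans (le_max_left _ _) (le_max_right _ _)) (le_trans (le_max_left _ _) hx)
  have hxφ' : x_φ' ≤ x := le_trans (le_trans (le_max_right _ _) (le_max_right _ _)) (le_trans (le_max_left _ _) hx)
  have hxexp : Real.exp L₀ ≤ x := le_trans (le_max_right _ _) hx
  have hx1 : 1 < x := lt_of_lt_of_le (Real.one_lt_exp_iff.2 (by linarith only [hL₀16])) hxexp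
  have hx0 : 0 < x := by linarith only [hx1]
  set L : ℝ := Real.log x with hL
  have hLL₀ : L₀ ≤ L := by
    have := Real.log_le_log (Real.exp_pos _) hxexp; rwa [Real.log_exp] at this
  have hL16 : 16 ≤ L := le_trans hL₀16 hLL₀
  have hLy : (y₂ : ℝ) + y₃ ≤ L := le_trans (le_trans (le_trans (le_max_right _ _) (le_max_left _ _)) (le_max_left _ _)) hLL₀
  have hLφ : 10 ^ 6 / c_φ ≤ L := le_trans (le_trans (le_trans (le_max_left _ _) (le_max_right _ _)) (le_max_left _ _)) hLL₀
  have hLκ : 3 / κ ≤ L := le_trans (le_trans (le_trans (le_max_right _ _) (le_max_right _ _)) (le_max_left _ _)) hLL₀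
  have hLu₀ : u₀ ^ 2 ≤ L := le_trans (le_max_right _ _) hLL₀
  have hL0 : 0 < L := by linarith only [hL16]
  -- `r = L^{1/5}`
  set r : ℝ := L ^ (1 / 5 : ℝ) with hr
  have hr0 : 0 < r := Real.rpow_pos_of_pos hL0 _
  have hr5 : r ^ 5 = L := by
    rw [hr, ← Real.rpow_natCast, ← Real.rpow_mul hL0.le]; norm_num
  have hr1 : 1 ≤ r := by
    by_contra h; push Not at h
    have : r ^ 5 < 1 := pow_lt_one₀ hr0.le h (by norm_num)
    linarith only [this, hr5, hL16]
  have hrL : r ≤ L := by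
    calc r = r * 1 := (mul_one r).symm
      _ ≤ r * r ^ 4 := mul_le_mul_of_nonneg_left (one_le_pow₀ hr1) hr0.le
      _ = L := by rw [← hr5]; ring
  set ℓ : ℝ := Real.log y with hℓ
  have hℓr : ℓ ≤ r := hylog
  have hy_ge : L ^ 4 ≤ (y : ℝ) := hy4
  have hL4 : (16 : ℝ) ^ 4 ≤ L ^ 4 := pow_le_pow_left₀ (by norm_num) hL16 4
  have h65536 : (65536 : ℝ) ≤ y := by norm_num at hL4; linarith only [hL4, hy_ge]
  have hy0 : (0 : ℝ) < y := by linarith only [h65536]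
  have hy1 : (1 : ℝ) < y := by linarith only [h65536]
  have hℓ0 : 0 < ℓ := Real.log_pos hy1
  have hyL : L ≤ (y : ℝ) := by
    calc L ≤ L ^ 4 := by
          calc L = L * 1 * 1 * 1 := by ring
            _ ≤ L * L * L * L := by gcongr <;> linarith only [hL16]
            _ = L ^ 4 := by ring
      _ ≤ y := hy_ge
  have hℓ11 : 11 ≤ ℓ := by
    -- `log 65536 = 16 log 2 ≥ 11.09`
    have h2 : Real.log 65536 = 16 * Real.log 2 := by
      rw [show (65536 : ℝ) = 2 ^ 16 by norm_num, Real.log_pow]; norm_num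
    have h3 : Real.log 65536 ≤ ℓ := Real.log_le_log (by norm_num) h65536
    have h4 := Real.log_two_gt_d9
    linarith only [h2, h3, h4]
  have hℓ1 : 1 ≤ ℓ := by linarith only [hℓ11]
  have hy2 : 2 ≤ y := by
    have : (2 : ℝ) ≤ y := by linarith only [h65536]
    exact_mod_cast this
  have hyx : (y : ℝ) ≤ x := (Real.log_le_log_iff hy0 hx0).1 (le_trans hℓr hrL)
  have hlx3 : Real.log x ^ 3 ≤ y := by
    have : L ^ 3 ≤ L ^ 4 := pow_le_pow_right₀ (by linarith only [hL16]) (by norm_num)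
    linarith only [this, hy_ge]
  have hy₃0 : (0 : ℝ) ≤ y₃ := Nat.cast_nonneg y₃
  have hy₂0 : (0 : ℝ) ≤ y₂ := Nat.cast_nonneg y₂
  have hyy₂' : (y₂ : ℝ) ≤ (y : ℝ) := by linarith only [hLy, hyL, hy₃0]
  have hyy₃' : (y₃ : ℝ) ≤ (y : ℝ) := by linarith only [hLy, hyL, hy₂0]
  have hyy₂ : y₂ ≤ y := by exact_mod_cast hyy₂'
  have hyy₃ : y₃ ≤ y := by exact_mod_cast hyy₃'
  -- `u = L/ℓ ≥ r⁴ ≥ u₀`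
  set u : ℝ := L / ℓ with hu
  have huℓ : u * ℓ = L := by rw [hu]; field_simp
  have hu_r4 : r ^ 4 ≤ u := by
    rw [hu, le_div_iff₀ hℓ0]
    calc r ^ 4 * ℓ ≤ r ^ 4 * r := mul_le_mul_of_nonneg_left hℓr (by positivity)
      _ = L := by rw [← hr5]; ring
  have hu_u₀ : u₀ ≤ u := by
    have h1 : u₀ ^ 5 ≤ (r ^ 4) ^ 5 := by
      calc u₀ ^ 5 ≤ u₀ ^ 8 := pow_le_pow_right₀ hu₀1 (by norm_num)
        _ = (u₀ ^ 2) ^ 4 := by ring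
        _ ≤ L ^ 4 := pow_le_pow_left₀ (by positivity) hLu₀ 4
        _ = (r ^ 4) ^ 5 := by rw [← hr5]; ring
    exact le_trans (le_of_pow_le_pow_left₀ (by norm_num) (by positivity) h1) hu_r4
  have hu2 : 2 ≤ u := le_trans hu₀2 hu_u₀
  have hu_cB : 1 / (c_B * Real.log 2) + 1 ≤ u := le_trans (le_trans (le_max_right _ _) (le_max_left _ _)) hu_u₀
  have hu_τ : 10 ^ 4 / (9 * c_φ) ≤ u := le_trans (le_trans (le_max_left _ _) (le_max_right _ _)) hu_u₀
  have hu_η : 169 * 10 ^ 12 / c_φ ≤ u := le_trans (le_trans (le_max_right _ _) (le_max_right _ _)) hu_u₀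
  -- ### `α`, `φ`
  set α : ℝ := saddlePoint x y with hαdef
  have hα35 : 3 / 5 ≤ α := h35 x y hx₃ hlx3 hyx
  have hα0 : 0 < α := by linarith only [hα35]
  have hEB : c_B * (u * Real.log (u + 1)) ≤ (y : ℝ) ^ (1 - α) := hB x y hxB hlx3 hyx
  have hE_cBu : c_B * u ≤ (y : ℝ) ^ (1 - α) := by
    have hlogu1 : 1 ≤ Real.log (u + 1) := by
      rw [Real.le_log_iff_exp_le (by linarith only [hu2])]
      have := Real.exp_one_lt_d9; linarith only [this, hu2]
    calc c_B * u = c_B * (u * 1) := by ring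
      _ ≤ c_B * (u * Real.log (u + 1)) := by gcongr
      _ ≤ (y : ℝ) ^ (1 - α) := hEB
  have hα1 : α < 1 := by
    by_contra h; push Not at h
    have h1 : (y : ℝ) ^ (1 - α) ≤ 1 := Real.rpow_le_one_of_one_le_of_nonpos hy1.le (by linarith only [h])
    have hl2 : 0 < Real.log 2 := Real.log_pos one_lt_two
    have hlog2 : Real.log 2 ≤ Real.log (u + 1) := Real.log_le_log two_pos (by linarith only [hu2])
    have h3 : 1 / (c_B * Real.log 2) < u := by linarith only [hu_cB]
    rw [div_lt_iff₀ (by positivity)] at h3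
    have h4 : 1 < c_B * (u * Real.log (u + 1)) := by
      calc (1 : ℝ) < u * (c_B * Real.log 2) := h3
        _ = c_B * (u * Real.log 2) := by ring
        _ ≤ c_B * (u * Real.log (u + 1)) := by gcongr
    linarith only [h1, h4, hEB]
  set φ : ℝ := saddlePhi₂ α y with hφdef
  have hφlo' : c_φ * (L * ℓ) ≤ φ := hφlo x y hxφ hlx3 hyx
  have hφhi' : φ ≤ 3 * L * ℓ := hφhi x y hxφ' hlx3 hyx
  have hcφL : 10 ^ 6 ≤ c_φ * L := by rwa [div_le_iff₀ hc_φ, mul_comm] at hLφ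
  have hφ_ge : (10 : ℝ) ^ 6 ≤ φ := by
    calc (10 : ℝ) ^ 6 ≤ c_φ * L := hcφL
      _ = c_φ * (L * 1) := by ring
      _ ≤ c_φ * (L * ℓ) := by gcongr
      _ ≤ φ := hφlo'
  have hφ0 : 0 < φ := by linarith only [hφ_ge]
  set Φ : ℝ := Real.sqrt φ with hΦ
  have hΦ0 : 0 < Φ := Real.sqrt_pos.2 hφ0
  have hΦsq : Φ ^ 2 = φ := Real.sq_sqrt hφ0.le
  -- `τ = 100/Φ`
  set τ : ℝ := 100 / Φ with hτ
  have hτ0 : 0 < τ := by positivity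
  have hτΦ : τ * Φ = 100 := by rw [hτ]; field_simp
  have hτsqφ : τ ^ 2 * φ = 10 ^ 4 := by
    calc τ ^ 2 * φ = (τ * Φ) ^ 2 := by rw [← hΦsq]; ring
      _ = 10 ^ 4 := by rw [hτΦ]; norm_num
  have hτ3φ : τ ^ 3 * φ = 10 ^ 4 * τ := by
    calc τ ^ 3 * φ = τ * (τ ^ 2 * φ) := by ring
      _ = 10 ^ 4 * τ := by rw [hτsqφ]; ring
  have hπ := Real.pi_gt_d2
  have hπ' := Real.pi_lt_d4
  have hτπ : τ ≤ Real.pi / ℓ := by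
    rw [hτ, div_le_div_iff₀ hΦ0 hℓ0]
    have h1 : 10 ^ 4 * ℓ ≤ 9 * c_φ * L := by
      have h2 : 10 ^ 4 ≤ u * (9 * c_φ) := by rwa [div_le_iff₀ (by positivity)] at hu_τ
      have h3 := mul_le_mul_of_nonneg_right h2 hℓ0.le
      calc 10 ^ 4 * ℓ ≤ u * (9 * c_φ) * ℓ := h3
        _ = 9 * c_φ * (u * ℓ) := by ring
        _ = 9 * c_φ * L := by rw [huℓ]
    have h1' : 10 ^ 4 * ℓ ^ 2 ≤ 9 * φ := by
      have h4 := mul_le_mul_of_nonneg_right h1 hℓ0.le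
      calc 10 ^ 4 * ℓ ^ 2 = 10 ^ 4 * ℓ * ℓ := by ring
        _ ≤ 9 * c_φ * L * ℓ := h4
        _ = 9 * (c_φ * (L * ℓ)) := by ring
        _ ≤ 9 * φ := by linarith only [hφlo']
    have hpi2 : 9 ≤ Real.pi ^ 2 := by
      rw [sq]; exact le_trans (by norm_num) (mul_le_mul hπ.le hπ.le (by norm_num) Real.pi_pos.le)
    have h2 : (100 * ℓ) ^ 2 ≤ (Real.pi * Φ) ^ 2 := by
      rw [mul_pow, mul_pow, hΦsq]
      have h5 := mul_le_mul_of_nonneg_right hpi2 hφ0.le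
      calc (100 : ℝ) ^ 2 * ℓ ^ 2 = 10 ^ 4 * ℓ ^ 2 := by norm_num
        _ ≤ 9 * φ := h1'
        _ ≤ Real.pi ^ 2 * φ := h5
    have h3 : 100 * ℓ ≤ Real.pi * Φ := le_of_pow_le_pow_left₀ two_ne_zero (by positivity) h2
    linarith only [h3]
  have hπℓ : Real.pi / ℓ ≤ 1 := by rw [div_le_one hℓ0]; linarith only [hπ', hℓ11]
  have hη : 13 * τ ^ 3 * Real.log y * φ ≤ 1 := by
    rw [← hℓ, show 13 * τ ^ 3 * ℓ * φ = 13 * (τ ^ 3 * φ) * ℓ by ring, hτ3φ,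
      show 13 * (10 ^ 4 * τ) * ℓ = 13 * 10 ^ 6 * ℓ / Φ by rw [hτ]; ring, div_le_iff₀ hΦ0]
    have h1 : 169 * 10 ^ 12 * ℓ ≤ c_φ * L := by
      have h2 : 169 * 10 ^ 12 ≤ u * c_φ := by rwa [div_le_iff₀ hc_φ] at hu_η
      have h3 := mul_le_mul_of_nonneg_right h2 hℓ0.le
      calc 169 * 10 ^ 12 * ℓ ≤ u * c_φ * ℓ := h3
        _ = c_φ * (u * ℓ) := by ring
        _ = c_φ * L := by rw [huℓ]
    have h2 : (13 * 10 ^ 6 * ℓ) ^ 2 ≤ φ := by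
      have h4 := mul_le_mul_of_nonneg_right h1 hℓ0.le
      have h5 : (13 * 10 ^ 6 * ℓ) ^ 2 = 169 * 10 ^ 12 * ℓ * ℓ := by ring
      have h6 : c_φ * L * ℓ = c_φ * (L * ℓ) := by ring
      rw [h5]; linarith only [h4, h6, hφlo']
    have h3 : 13 * 10 ^ 6 * ℓ ≤ Φ := by rw [hΦ, Real.le_sqrt (by positivity) hφ0.le]; exact h2
    linarith only [h3]
  -- ### `T = κ √y ≥ 3`
  have hsqrty : L ^ 2 ≤ (y : ℝ) ^ (1 / 2 : ℝ) := by
    have h1 := Real.rpow_le_rpow (by positivity) hy_ge (by norm_num : (0 : ℝ) ≤ 1 / 2)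
    rwa [show L ^ 4 = (L ^ 2) ^ 2 by ring, ← Real.rpow_natCast, ← Real.rpow_mul (by positivity),
      show ((2 : ℕ) : ℝ) * (1 / 2) = 1 by norm_num, Real.rpow_one] at h1
  have hT3 : 3 ≤ κ * (y : ℝ) ^ (1 / 2 : ℝ) := by
    have h1 : 3 ≤ κ * L := by rwa [div_le_iff₀ hκ, mul_comm] at hLκ
    have h2 : κ * L ≤ κ * L ^ 2 := by
      apply mul_le_mul_of_nonneg_left _ hκ.le; nlinarith only [hL16]
    have h3 : κ * L ^ 2 ≤ κ * (y : ℝ) ^ (1 / 2 : ℝ) := mul_le_mul_of_nonneg_left hsqrty hκ.le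
    linarith only [h1, h2, h3]
  -- ### decay of `ζ(s,y)/ζ(α,y)`
  have hζ0 : 0 < smoothZeta α y := smoothZeta_pos hα0
  have hdec1 : ∀ t : ℝ, Real.pi / Real.log y ≤ |t| → |t| ≤ 3 →
      ‖smoothZetaC ((α : ℂ) + t * I) y‖ / smoothZeta α y ≤ Real.exp (-(A₂ * r)) := by
    intro t ht1 ht2
    have hD := h2 y hyy₂ α hα35 hα1.le t ht1 ht2
    have hu_rl : (r * ℓ) ^ 2 ≤ u := by
      rw [hu, le_div_iff₀ hℓ0]
      have : ℓ ^ 3 ≤ r ^ 3 := pow_le_pow_left₀ hℓ0.le hℓr 3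
      calc (r * ℓ) ^ 2 * ℓ = r ^ 2 * ℓ ^ 3 := by ring
        _ ≤ r ^ 2 * r ^ 3 := mul_le_mul_of_nonneg_left this (by positivity)
        _ = L := by rw [← hr5]; ring
    have hE : Real.sqrt c_B * (r * ℓ) ≤ (y : ℝ) ^ ((1 - α) / 2) := by
      have h1 : (Real.sqrt c_B * (r * ℓ)) ^ 2 ≤ (y : ℝ) ^ (1 - α) := by
        rw [mul_pow, Real.sq_sqrt hc_B.le]
        calc c_B * (r * ℓ) ^ 2 ≤ c_B * u := by gcongr
          _ ≤ (y : ℝ) ^ (1 - α) := hE_cBu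
      have h2' : (y : ℝ) ^ ((1 - α) / 2) = Real.sqrt ((y : ℝ) ^ (1 - α)) := by
        rw [Real.sqrt_eq_rpow, ← Real.rpow_mul hy0.le]; ring_nf
      rw [h2', Real.le_sqrt (by positivity) (by positivity)]
      exact h1
    have hexpM : Real.exp (-(1 / 25) * ∑ p ∈ Nat.primesLE y, (p : ℝ) ^ (-α) * (1 - Real.cos (t * Real.log p))) ≤
        Real.exp (-(A₂ * r)) := by
      rw [Real.exp_le_exp]
      have h3' : A₂ * r * ℓ ≤ c₂ / 25 * (y : ℝ) ^ ((1 - α) / 2) := by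
        rw [hA₂]
        have := mul_le_mul_of_nonneg_left hE (by positivity : 0 ≤ c₂ / 25)
        calc c₂ * Real.sqrt c_B / 25 * r * ℓ = c₂ / 25 * (Real.sqrt c_B * (r * ℓ)) := by ring
          _ ≤ _ := this
      have h4 : A₂ * r ≤ 1 / 25 * (c₂ * ((y : ℝ) ^ ((1 - α) / 2) / Real.log y)) := by
        rw [← hℓ, show 1 / 25 * (c₂ * ((y : ℝ) ^ ((1 - α) / 2) / ℓ)) = (c₂ / 25 * (y : ℝ) ^ ((1 - α) / 2)) / ℓ by ring,
          le_div_iff₀ hℓ0]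
        exact h3'
      have h5 := mul_le_mul_of_nonneg_left hD (by norm_num : (0 : ℝ) ≤ 1 / 25)
      linarith only [h4, h5]
    rw [div_le_iff₀ hζ0]
    calc ‖smoothZetaC ((α : ℂ) + t * I) y‖ ≤ _ := norm_smoothZetaC_le_mul_exp hα35 t y
      _ ≤ smoothZeta α y * Real.exp (-(A₂ * r)) := mul_le_mul_of_nonneg_left hexpM hζ0.le
      _ = Real.exp (-(A₂ * r)) * smoothZeta α y := mul_comm _ _
  have hdec2 : ∀ t : ℝ, 3 ≤ |t| → |t| ≤ κ * (y : ℝ) ^ (1 / 2 : ℝ) →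
      ‖smoothZetaC ((α : ℂ) + t * I) y‖ / smoothZeta α y ≤ Real.exp (-(A₃ * r ^ 3)) := by
    intro t ht1 ht2
    have hD := h3 y hyy₃ α hα35 hα1.le t ht1 ht2
    -- `c_B u ≥ c_B r⁴ ≥ c_B r³ ℓ`, so `y^{1-α}/ℓ ≥ c_B r³`
    have hE : c_B * r ^ 3 * ℓ ≤ (y : ℝ) ^ (1 - α) := by
      calc c_B * r ^ 3 * ℓ ≤ c_B * r ^ 3 * r := mul_le_mul_of_nonneg_left hℓr (by positivity)
        _ = c_B * r ^ 4 := by ring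
        _ ≤ c_B * u := by gcongr
        _ ≤ (y : ℝ) ^ (1 - α) := hE_cBu
    have hexpM : Real.exp (-(1 / 25) * ∑ p ∈ Nat.primesLE y, (p : ℝ) ^ (-α) * (1 - Real.cos (t * Real.log p))) ≤
        Real.exp (-(A₃ * r ^ 3)) := by
      rw [Real.exp_le_exp]
      have h4 : A₃ * r ^ 3 ≤ 1 / 25 * (c₃ * ((y : ℝ) ^ (1 - α) / Real.log y)) := by
        rw [← hℓ, hA₃, show 1 / 25 * (c₃ * ((y : ℝ) ^ (1 - α) / ℓ)) = (c₃ / 25 * (y : ℝ) ^ (1 - α)) / ℓ by ring,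
          le_div_iff₀ hℓ0]
        have := mul_le_mul_of_nonneg_left hE (by positivity : 0 ≤ c₃ / 25)
        calc c₃ * c_B / 25 * r ^ 3 * ℓ = c₃ / 25 * (c_B * r ^ 3 * ℓ) := by ring
          _ ≤ _ := this
      have h5 := mul_le_mul_of_nonneg_left hD (by norm_num : (0 : ℝ) ≤ 1 / 25)
      linarith only [h4, h5]
    rw [div_le_iff₀ hζ0]
    calc ‖smoothZetaC ((α : ℂ) + t * I) y‖ ≤ _ := norm_smoothZetaC_le_mul_exp hα35 t y
      _ ≤ smoothZeta α y * Real.exp (-(A₃ * r ^ 3)) := mul_le_mul_of_nonneg_left hexpM hζ0.le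
      _ = Real.exp (-(A₃ * r ^ 3)) * smoothZeta α y := mul_comm _ _
  exact ⟨hx1, hy2, hα35, hα1.le, hφ0, hφlo', hφhi', hL16, hℓ11, hτπ, hπℓ, hη, hdec1, hT3, hdec2⟩

/-- `C_λ = 2 + 6(2π|λ|) + 6(2π|λ|)² + (2π|λ|)³ ≤ 750 Λ³` for `|λ| ≤ Λ`, `Λ ≥ 1`. [folklore] -/
theorem decayConst_le {lam Λ : ℝ} (hΛ : 1 ≤ Λ) (hlam : |lam| ≤ Λ) :
    2 + 6 * (2 * π * |lam|) + 6 * (2 * π * |lam|) ^ 2 + (2 * π * |lam|) ^ 3 ≤ 750 * Λ ^ 3 := by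
  have hπ := Real.pi_lt_d4
  have hπ0 := Real.pi_pos
  have h0 : 0 ≤ |lam| := abs_nonneg lam
  have h1 : 2 * π * |lam| ≤ 6.2832 * Λ := by nlinarith
  have hm0 : 0 ≤ 2 * π * |lam| := by positivity
  have h2 : (2 * π * |lam|) ^ 2 ≤ (6.2832 * Λ) ^ 2 := pow_le_pow_left₀ hm0 h1 2
  have h3 : (2 * π * |lam|) ^ 3 ≤ (6.2832 * Λ) ^ 3 := pow_le_pow_left₀ hm0 h1 3
  have hΛ2 : Λ ≤ Λ ^ 3 := by nlinarith
  have hΛ3 : Λ ^ 2 ≤ Λ ^ 3 := by nlinarith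
  have hΛ1 : (1 : ℝ) ≤ Λ ^ 3 := by nlinarith
  nlinarith

set_option maxHeartbeats 1600000 in
/-- **The twisted smooth sums at the scales `x/e`, `1 ≤ e ≤ (log x)^{100}`.** For every `ε > 0` there
is `x₀` such that for `x ≥ x₀`, `(log x)^4 ≤ y ≤ exp((log x)^{1/5})`, `1 ≤ Λ`, `Λ⁸ ≤ y`,
`1 ≤ e ≤ (log x)^{100}` and `|λ| ≤ Λ`, with `α = α(x,y)`, `𝓜 = x^α ζ(α,y)/√(2π φ₂(α,y))`:
`‖∑_{n ∈ S(x/e, y)} (n e/x)²(1−ne/x)² e(λne/x) − e^{−α} 𝓜 Ŵ_λ(α)‖ ≤ e^{−α}(ε + e^{−66}) 𝓜/(1+|λ|)`,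
where `Ŵ_λ(α) = ∫₀¹ v^{α+1}(1−v)² e(λv) dv`. This is the saddle-point evaluation of
[HildebrandTenenbaum1986, §4] for the kernel `e^{−s} Ŵ_λ(s)` on the line `Re s = α(x,y)`, as used
on the major arcs in [Harper2016, §5]. [cite: HildebrandTenenbaum1986, §4 (Lemmas 10–11)] [cite: Harper2016, §5] -/
theorem scaledSum_main_term {ε : ℝ} (hε : 0 < ε) :
    ∃ x₀ : ℝ, ∀ (x : ℝ) (y : ℕ), x₀ ≤ x → Real.log x ^ 4 ≤ y → Real.log y ≤ Real.log x ^ (1 / 5 : ℝ) →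
      ∀ Λ : ℝ, 1 ≤ Λ → Λ ^ 8 ≤ (y : ℝ) → ∀ e : ℕ, 1 ≤ e → (e : ℝ) ≤ Real.log x ^ 100 → ∀ lam : ℝ, |lam| ≤ Λ →
      ‖(∑ n ∈ Nat.smoothNumbersUpTo ⌊x / e⌋₊ (y + 1), twistWeight lam (n / (x / e))) -
          ((((e : ℝ) ^ (-saddlePoint x y) * (x ^ saddlePoint x y * smoothZeta (saddlePoint x y) y /
              Real.sqrt (2 * Real.pi * saddlePhi₂ (saddlePoint x y) y)) : ℝ)) : ℂ) *
            twistMellin lam (saddlePoint x y)‖ ≤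
        (e : ℝ) ^ (-saddlePoint x y) * ((ε + Real.exp (-66)) * (x ^ saddlePoint x y * smoothZeta (saddlePoint x y) y /
          Real.sqrt (2 * Real.pi * saddlePhi₂ (saddlePoint x y) y)) / (1 + |lam|)) := by
  obtain ⟨A₂, A₃, κ, c_φ, hA₂, hA₃, hκ, hc_φ, x₁, hR⟩ := twist_range
  -- thresholds on `L = log x`
  set Q : ℝ := 93 * 10 ^ 6 / (c_φ * ε ^ 2) with hQ
  set Q₃ : ℝ := 164 * 10 ^ 6 / (c_φ * ε ^ 2) with hQ₃
  set m : ℝ := max 1 (2 / A₃) with hm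
  set L₁ : ℝ := max (max (max (max 16 (Q ^ 2)) (Q₃ ^ 2)) (max (122 * 10 ^ 7 / (A₂ ^ 10 * ε)) (147 * 10 ^ 6 * κ / ε)))
    (max (31000 / (κ ^ 2 * ε)) (m ^ 5)) with hL₁
  refine ⟨max x₁ (Real.exp L₁), fun x y hx hy4 hylog Λ hΛ1 hΛy e he1 heL lam hlam => ?_⟩
  have hx₁ : x₁ ≤ x := le_trans (le_max_left _ _) hx
  obtain ⟨hx1, hy2, hα35, hα1, hφ0, hφlo, hφhi, hL16, hℓ11, hτπ, hπℓ, hη, hdec1, hT3, hdec2⟩ :=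
    hR x y hx₁ hy4 hylog
  set α : ℝ := saddlePoint x y with hαdef
  have hα0 : 0 < α := by linarith only [hα35]
  set φ : ℝ := saddlePhi₂ α y with hφdef
  set Φ : ℝ := Real.sqrt φ with hΦ
  have hΦ0 : 0 < Φ := Real.sqrt_pos.2 hφ0
  have hΦsq : Φ ^ 2 = φ := Real.sq_sqrt hφ0.le
  set L : ℝ := Real.log x with hL
  set ℓ : ℝ := Real.log y with hℓ
  set r : ℝ := L ^ (1 / 5 : ℝ) with hr
  have hL0 : 0 < L := by linarith only [hL16]
  have hℓ0 : 0 < ℓ := by linarith only [hℓ11]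
  have hxexp : Real.exp L₁ ≤ x := le_trans (le_max_right _ _) hx
  have hLL₁ : L₁ ≤ L := by
    have := Real.log_le_log (Real.exp_pos _) hxexp; rwa [Real.log_exp] at this
  have hLQ : Q ^ 2 ≤ L :=
    le_trans (le_trans (le_trans (le_trans (le_max_right _ _) (le_max_left _ _)) (le_max_left _ _)) (le_max_left _ _)) hLL₁
  have hLQ₃ : Q₃ ^ 2 ≤ L :=
    le_trans (le_trans (le_trans (le_max_right _ _) (le_max_left _ _)) (le_max_left _ _)) hLL₁
  have hLA₂ : 122 * 10 ^ 7 / (A₂ ^ 10 * ε) ≤ L :=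
    le_trans (le_trans (le_trans (le_max_left _ _) (le_max_right _ _)) (le_max_left _ _)) hLL₁
  have hLκ : 147 * 10 ^ 6 * κ / ε ≤ L :=
    le_trans (le_trans (le_trans (le_max_right _ _) (le_max_right _ _)) (le_max_left _ _)) hLL₁
  have hLκ2 : 31000 / (κ ^ 2 * ε) ≤ L := le_trans (le_trans (le_max_left _ _) (le_max_right _ _)) hLL₁
  have hLm : m ^ 5 ≤ L := le_trans (le_trans (le_max_right _ _) (le_max_right _ _)) hLL₁
  -- `r`
  have hr0 : 0 < r := Real.rpow_pos_of_pos hL0 _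
  have hr5 : r ^ 5 = L := by
    rw [hr, ← Real.rpow_natCast, ← Real.rpow_mul hL0.le]; norm_num
  have hr1 : 1 ≤ r := by
    by_contra h; push Not at h
    have : r ^ 5 < 1 := pow_lt_one₀ hr0.le h (by norm_num)
    linarith only [this, hr5, hL16]
  have hrm : m ≤ r := by
    by_contra h; push Not at h
    have hm0 : 0 ≤ m := le_trans zero_le_one (le_max_left _ _)
    have : r ^ 5 < m ^ 5 := pow_lt_pow_left₀ h hr0.le (by norm_num)
    linarith only [this, hr5, hLm]
  have hℓr : ℓ ≤ r := hylog
  have hℓL : ℓ ≤ L := by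
    calc ℓ ≤ r := hℓr
      _ = r * 1 := (mul_one r).symm
      _ ≤ r * r ^ 4 := mul_le_mul_of_nonneg_left (one_le_pow₀ hr1) hr0.le
      _ = L := by rw [← hr5]; ring
  -- `r⁴ ≥ Q`, `r³ ≥ Q₃`
  have hr4Q : Q ≤ r ^ 4 := by
    have hQ0 : 0 ≤ Q := by positivity
    have h1 : Q ^ 2 ≤ (r ^ 4) ^ 2 := by
      calc Q ^ 2 ≤ L := hLQ
        _ = r ^ 5 := hr5.symm
        _ ≤ r ^ 8 := pow_le_pow_right₀ hr1 (by norm_num)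
        _ = (r ^ 4) ^ 2 := by ring
    exact le_of_pow_le_pow_left₀ two_ne_zero (by positivity) h1
  have hr3Q : Q₃ ≤ r ^ 3 := by
    have h1 : Q₃ ^ 2 ≤ (r ^ 3) ^ 2 := by
      calc Q₃ ^ 2 ≤ L := hLQ₃
        _ = r ^ 5 := hr5.symm
        _ ≤ r ^ 6 := pow_le_pow_right₀ hr1 (by norm_num)
        _ = (r ^ 3) ^ 2 := by ring
    exact le_of_pow_le_pow_left₀ two_ne_zero (by positivity) h1
  -- `log e ≤ 100 log L ≤ 500 r`
  have he0 : (0 : ℝ) < e := by exact_mod_cast he1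
  have hloge : Real.log e ≤ 500 * r := by
    have h1 : Real.log e ≤ 100 * Real.log L := by
      calc Real.log e ≤ Real.log (L ^ 100) := Real.log_le_log he0 heL
        _ = 100 * Real.log L := by rw [Real.log_pow]; norm_num
    have h2 : Real.log L ≤ 5 * r := by
      have := Real.log_le_rpow_div hL0.le (by norm_num : (0:ℝ) < 1 / 5)
      rw [← hr] at this; linarith only [this]
    linarith only [h1, h2]
  have hloge0 : 0 ≤ Real.log e := Real.log_nonneg (by exact_mod_cast he1)
  -- `Φ ≤ 2L`, `ℓ/(c_φ L) ≤ 1/(c_φ r⁴)`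
  have hΦle : Φ ≤ 2 * L := by
    rw [hΦ, Real.sqrt_le_left (by positivity)]
    have h1 : L * ℓ ≤ L * L := mul_le_mul_of_nonneg_left hℓL hL0.le
    nlinarith only [hφhi, h1]
  -- `y`, `√y`, `Λ`
  have hy0 : (0 : ℝ) < y := by exact_mod_cast lt_of_lt_of_le two_pos hy2
  have hsqy : ((y : ℝ) ^ (1 / 2 : ℝ)) ^ 2 = y := by
    rw [← Real.rpow_natCast, ← Real.rpow_mul hy0.le]; norm_num
  have hsqy0 : 0 < (y : ℝ) ^ (1 / 2 : ℝ) := Real.rpow_pos_of_pos hy0 _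
  have hΛ4 : Λ ^ 4 ≤ (y : ℝ) ^ (1 / 2 : ℝ) := by
    have h1 : (Λ ^ 4) ^ 2 ≤ ((y : ℝ) ^ (1 / 2 : ℝ)) ^ 2 := by
      rw [hsqy]
      calc (Λ ^ 4) ^ 2 = Λ ^ 8 := by ring
        _ ≤ (y : ℝ) := hΛy
    exact le_of_pow_le_pow_left₀ two_ne_zero hsqy0.le h1
  have hL2sq : L ^ 2 ≤ (y : ℝ) ^ (1 / 2 : ℝ) := by
    have h1 : (L ^ 2) ^ 2 ≤ ((y : ℝ) ^ (1 / 2 : ℝ)) ^ 2 := by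
      rw [hsqy]
      calc (L ^ 2) ^ 2 = L ^ 4 := by ring
        _ ≤ (y : ℝ) := hy4
    exact le_of_pow_le_pow_left₀ two_ne_zero hsqy0.le h1
  have hsqy_exp : (y : ℝ) ^ (1 / 2 : ℝ) ≤ Real.exp (r / 2) := by
    rw [Real.rpow_def_of_pos hy0, ← hℓ]
    exact Real.exp_le_exp.2 (by linarith only [hℓr])
  have hΛexp : Λ ≤ Real.exp (r / 8) := by
    have h1 : Λ ^ 8 ≤ Real.exp (r / 8) ^ 8 := by
      rw [← Real.exp_nat_mul]
      calc Λ ^ 8 ≤ y := hΛy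
        _ = Real.exp ℓ := by rw [hℓ, Real.exp_log hy0]
        _ ≤ Real.exp ((8 : ℕ) * (r / 8)) := Real.exp_le_exp.2 (by push_cast; linarith only [hℓr])
    exact le_of_pow_le_pow_left₀ (by norm_num) (Real.exp_pos _).le h1
  have hΛ0 : 0 < Λ := by linarith only [hΛ1]
  have hlam1 : 1 + |lam| ≤ 2 * Λ := by linarith only [hlam, hΛ1]
  -- ### apply the parametric theorem
  have hmain := norm_scaledSum_sub_main_le_param hx1 hy2 hα35 hα1 hφ0 hτπ hπℓ hη hT3
    (Real.exp_pos _).le (Real.exp_pos _).le hdec1 hdec2 he1 lam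
  rw [← hφdef] at hmain
  rw [← hΦ] at hmain
  rw [← hℓ] at hmain
  rw [← hαdef] at hmain
  refine hmain.trans ?_
  -- ### the main constant: `c = 𝓜 Φ/√(2π)`
  set M : ℝ := x ^ α * smoothZeta α y / Real.sqrt (2 * Real.pi * φ) with hM
  set ρ : ℝ := (e : ℝ) ^ (-α) with hρ
  have hρ0 : 0 < ρ := Real.rpow_pos_of_pos he0 _
  have hζ0 : 0 < smoothZeta α y := smoothZeta_pos hα0
  have hx0 : 0 < x := by linarith only [hx1]
  have hM0 : 0 < M := by rw [hM]; have := Real.pi_pos; positivity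
  have hs2π : (5 / 2 : ℝ) ≤ Real.sqrt (2 * Real.pi) := by
    rw [Real.le_sqrt (by norm_num) (by positivity)]; have := Real.pi_gt_d2; nlinarith
  have hs2π0 : 0 < Real.sqrt (2 * Real.pi) := by linarith only [hs2π]
  have hc : x ^ α * smoothZeta α y / (2 * Real.pi) = M * Φ / Real.sqrt (2 * Real.pi) := by
    have e' := SaddleKernel.main_const_identity hφ0 (x ^ α * smoothZeta α y)
    rw [← hM, Real.sqrt_div' _ hφ0.le, ← hΦ] at e'
    rw [← e']
    field_simp
  rw [hc]
  -- ### it suffices to bound `bracket · Φ · (1+|λ|) ≤ (5/2)(ε + e^{-66})`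
  set Br : ℝ := (2950 * ℓ + 8 + 8 * Real.log e) / (φ * (1 + |lam|)) +
      2 / (1 + |lam|) * (Real.exp (-(φ / 4) * (100 / Φ) ^ 2) * Real.sqrt (4 * Real.pi / φ)) +
      ((2 / (1 + |lam|)) * Real.exp (-72) * Real.sqrt (125 * Real.pi ^ 3 / φ) +
        20 * Real.pi * Real.exp (-(A₂ * r)) / (α * (1 + |lam|)) +
        2 * Real.pi * Real.exp (-(A₃ * r ^ 3)) * (κ * (y : ℝ) ^ (1 / 2 : ℝ)) +
        2 * Real.pi * (2 + 6 * (2 * π * |lam|) + 6 * (2 * π * |lam|) ^ 2 + (2 * π * |lam|) ^ 3) /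
          (κ * (y : ℝ) ^ (1 / 2 : ℝ)) ^ 2) with hBr
  have hlam0 : 0 < 1 + |lam| := by positivity
  suffices hkey : Br * Φ * (1 + |lam|) ≤ 5 / 2 * (ε + Real.exp (-66)) by
    have h1 : M * Φ / Real.sqrt (2 * Real.pi) * ρ * Br =
        ρ * ((Br * Φ * (1 + |lam|)) * (M / (Real.sqrt (2 * Real.pi) * (1 + |lam|)))) := by
      field_simp
    rw [h1]
    apply mul_le_mul_of_nonneg_left _ hρ0.le
    calc Br * Φ * (1 + |lam|) * (M / (Real.sqrt (2 * Real.pi) * (1 + |lam|)))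
        ≤ 5 / 2 * (ε + Real.exp (-66)) * (M / (Real.sqrt (2 * Real.pi) * (1 + |lam|))) :=
          mul_le_mul_of_nonneg_right hkey (by positivity)
      _ = (ε + Real.exp (-66)) * M / (1 + |lam|) * ((5 / 2) / Real.sqrt (2 * Real.pi)) := by
          field_simp
      _ ≤ (ε + Real.exp (-66)) * M / (1 + |lam|) * 1 := by
          apply mul_le_mul_of_nonneg_left _ (by positivity)
          rw [div_le_one hs2π0]; exact hs2π
      _ = (ε + Real.exp (-66)) * M / (1 + |lam|) := mul_one _
  -- ### expand `Br Φ (1+|λ|)` into six terms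
  have hexpand : Br * Φ * (1 + |lam|) =
      (2950 * ℓ + 8 + 8 * Real.log e) / Φ +
      2 * Real.exp (-(φ / 4) * (100 / Φ) ^ 2) * (Real.sqrt (4 * Real.pi / φ) * Φ) +
      2 * Real.exp (-72) * (Real.sqrt (125 * Real.pi ^ 3 / φ) * Φ) +
      20 * Real.pi * Real.exp (-(A₂ * r)) * Φ / α +
      2 * Real.pi * Real.exp (-(A₃ * r ^ 3)) * (κ * (y : ℝ) ^ (1 / 2 : ℝ)) * Φ * (1 + |lam|) +
      2 * Real.pi * (2 + 6 * (2 * π * |lam|) + 6 * (2 * π * |lam|) ^ 2 + (2 * π * |lam|) ^ 3) /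
          (κ * (y : ℝ) ^ (1 / 2 : ℝ)) ^ 2 * Φ * (1 + |lam|) := by
    rw [hBr, ← hΦsq]
    field_simp
    ring
  rw [hexpand]
  -- `√(4π/φ) Φ = √(4π)`, `√(125π³/φ) Φ = √(125 π³)`
  have hsq1 : Real.sqrt (4 * Real.pi / φ) * Φ = Real.sqrt (4 * Real.pi) := by
    rw [Real.sqrt_div' _ hφ0.le, hΦ]; field_simp
  have hsq2 : Real.sqrt (125 * Real.pi ^ 3 / φ) * Φ = Real.sqrt (125 * Real.pi ^ 3) := by
    rw [Real.sqrt_div' _ hφ0.le, hΦ]; field_simp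
  rw [hsq1, hsq2]
  have hπ4 := Real.pi_lt_d4
  have hπ0 := Real.pi_pos
  -- ### T1: `(2950 ℓ + 8 + 8 log e)/Φ ≤ 3000 ℓ/Φ + 4000 r/Φ ≤ (5/8) ε`
  have hT1 : (2950 * ℓ + 8 + 8 * Real.log e) / Φ ≤ 5 / 8 * ε := by
    have h1 : c_φ * r ^ 4 * ℓ ^ 2 ≤ φ := by
      have h2 : r ^ 4 * ℓ ≤ L := by
        calc r ^ 4 * ℓ ≤ r ^ 4 * r := mul_le_mul_of_nonneg_left hℓr (by positivity)
          _ = L := by rw [← hr5]; ring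
      calc c_φ * r ^ 4 * ℓ ^ 2 = c_φ * ((r ^ 4 * ℓ) * ℓ) := by ring
        _ ≤ c_φ * (L * ℓ) := by gcongr
        _ ≤ φ := hφlo
    have h1' : c_φ * r ^ 5 ≤ φ := by
      calc c_φ * r ^ 5 = c_φ * (L * 1) := by rw [hr5]; ring
        _ ≤ c_φ * (L * ℓ) := by gcongr; linarith only [hℓ11]
        _ ≤ φ := hφlo
    -- `3000 ℓ ≤ (5ε/16) Φ`
    have h3 : 93 * 10 ^ 6 ≤ c_φ * ε ^ 2 * r ^ 4 := by
      have := hr4Q; rw [hQ, div_le_iff₀ (by positivity)] at this; linarith only [this]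
    have h4 : (3000 * ℓ) ^ 2 ≤ (5 / 16 * ε * Φ) ^ 2 := by
      rw [mul_pow (5 / 16 * ε), hΦsq]
      have h5 := mul_le_mul_of_nonneg_right h3 (by positivity : 0 ≤ ℓ ^ 2)
      nlinarith only [h1, h5, hε, hc_φ]
    have h6 : 3000 * ℓ ≤ 5 / 16 * ε * Φ := le_of_pow_le_pow_left₀ two_ne_zero (by positivity) h4
    -- `4000 r ≤ (5ε/16) Φ`
    have h7 : 164 * 10 ^ 6 ≤ c_φ * ε ^ 2 * r ^ 3 := by
      have := hr3Q; rw [hQ₃, div_le_iff₀ (by positivity)] at this; linarith only [this]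
    have h8 : (4000 * r) ^ 2 ≤ (5 / 16 * ε * Φ) ^ 2 := by
      rw [mul_pow (5 / 16 * ε), hΦsq]
      have h9 := mul_le_mul_of_nonneg_right h7 (by positivity : 0 ≤ r ^ 2)
      nlinarith only [h1', h9, hε, hc_φ]
    have h10 : 4000 * r ≤ 5 / 16 * ε * Φ := le_of_pow_le_pow_left₀ two_ne_zero (by positivity) h8
    have h11 : 2950 * ℓ + 8 + 8 * Real.log e ≤ 3000 * ℓ + 4000 * r := by nlinarith only [hloge, hℓ11]
    rw [div_le_iff₀ hΦ0]
    linarith only [h6, h10, h11]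
  -- ### fixed constants: `2 e^{-φτ²/4} √(4π) + 2 e^{-72} √(125π³) ≤ (5/2) e^{-66}`
  have hT23 : 2 * Real.exp (-(φ / 4) * (100 / Φ) ^ 2) * Real.sqrt (4 * Real.pi) +
      2 * Real.exp (-72) * Real.sqrt (125 * Real.pi ^ 3) ≤ 5 / 2 * Real.exp (-66) := by
    have hτ2 : φ / 4 * (100 / Φ) ^ 2 = 2500 := by
      rw [div_pow, hΦsq]; field_simp; norm_num
    have he1 : Real.exp (-(φ / 4) * (100 / Φ) ^ 2) ≤ Real.exp (-72) := by
      rw [Real.exp_le_exp, neg_mul, hτ2]; norm_num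
    have hs4 : Real.sqrt (4 * Real.pi) ≤ 4 := by
      rw [Real.sqrt_le_left (by norm_num)]; nlinarith only [hπ4]
    have hs125 : Real.sqrt (125 * Real.pi ^ 3) ≤ 63 := by
      rw [Real.sqrt_le_left (by norm_num)]
      have : Real.pi ^ 3 ≤ 3.1416 ^ 3 := pow_le_pow_left₀ hπ0.le hπ4.le 3
      nlinarith only [this]
    have he6 : Real.exp (-72) * 134 ≤ 5 / 2 * Real.exp (-66) := by
      have h1 : Real.exp (-66) = Real.exp (-72) * Real.exp 6 := by rw [← Real.exp_add]; norm_num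
      rw [h1]
      have h2 : (134 : ℝ) ≤ 5 / 2 * Real.exp 6 := by
        have h3 : (2.7182818283 : ℝ) ^ 6 ≤ Real.exp 1 ^ 6 := pow_le_pow_left₀ (by norm_num) Real.exp_one_gt_d9.le 6
        rw [← Real.exp_nat_mul] at h3; norm_num at h3
        nlinarith only [h3]
      nlinarith only [h2, Real.exp_pos (-72)]
    have e0 := Real.exp_pos (-(φ / 4) * (100 / Φ) ^ 2)
    have e72 := Real.exp_pos (-72 : ℝ)
    nlinarith only [he1, hs4, hs125, he6, e0, e72, Real.sqrt_nonneg (4 * Real.pi), Real.sqrt_nonneg (125 * Real.pi ^ 3)]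
  -- ### T4: `20π e^{-A₂ r} Φ/α ≤ (5/8) ε`
  have hT4 : 20 * Real.pi * Real.exp (-(A₂ * r)) * Φ / α ≤ 5 / 8 * ε := by
    have hz : 0 < A₂ * r := by positivity
    have h1 := exp_neg_le_factorial_div_pow hz
    have h2 : (A₂ * r) ^ 10 = A₂ ^ 10 * L ^ 2 := by rw [mul_pow, show r ^ 10 = (r ^ 5) ^ 2 by ring, hr5]
    rw [h2] at h1
    have h3 : 122 * 10 ^ 7 ≤ A₂ ^ 10 * ε * L := by
      have := hLA₂; rw [div_le_iff₀ (by positivity)] at this; linarith only [this]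
    rw [div_le_iff₀ hα0]
    calc 20 * Real.pi * Real.exp (-(A₂ * r)) * Φ ≤ 20 * 3.1416 * (3628800 / (A₂ ^ 10 * L ^ 2)) * (2 * L) := by
          apply mul_le_mul (mul_le_mul (by nlinarith only [hπ4]) h1 (Real.exp_pos _).le (by positivity)) hΦle hΦ0.le
            (by positivity)
      _ = (20 * 3.1416 * 3628800 * 2) / (A₂ ^ 10 * L) := by field_simp
      _ ≤ 5 / 8 * ε * (3 / 5) := by
          rw [div_le_iff₀ (by positivity)]; nlinarith only [h3, hε]
      _ ≤ 5 / 8 * ε * α := by nlinarith only [hα35, hε]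
  -- ### T5: `2π e^{-A₃ r³} κ √y Φ (1+|λ|) ≤ (5/8) ε`
  have hT5 : 2 * Real.pi * Real.exp (-(A₃ * r ^ 3)) * (κ * (y : ℝ) ^ (1 / 2 : ℝ)) * Φ * (1 + |lam|) ≤ 5 / 8 * ε := by
    -- `A₃ r³ ≥ r + 5r/8` since `A₃ r² ≥ A₃ m r ≥ 2`
    have hA3r : r + (r / 2 + r / 8) ≤ A₃ * r ^ 3 := by
      have h1 : 2 / A₃ ≤ r := le_trans (le_max_right _ _) hrm
      have h2 : 2 ≤ A₃ * r := by rw [div_le_iff₀ hA₃] at h1; linarith only [h1]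
      have h3 : 2 * r ≤ A₃ * r ^ 2 := by nlinarith only [h2, hr0]
      have h4 : A₃ * r ^ 2 ≤ A₃ * r ^ 3 := by
        apply mul_le_mul_of_nonneg_left _ hA₃.le; nlinarith only [hr1, hr0]
      linarith only [h3, h4, hr0]
    have hexp : Real.exp (-(A₃ * r ^ 3)) * ((y : ℝ) ^ (1 / 2 : ℝ) * (1 + |lam|)) ≤ 2 * Real.exp (-r) := by
      calc Real.exp (-(A₃ * r ^ 3)) * ((y : ℝ) ^ (1 / 2 : ℝ) * (1 + |lam|))
          ≤ Real.exp (-(A₃ * r ^ 3)) * (Real.exp (r / 2) * (2 * Real.exp (r / 8))) := by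
            apply mul_le_mul_of_nonneg_left _ (Real.exp_pos _).le
            exact mul_le_mul hsqy_exp (hlam1.trans (by linarith only [hΛexp])) hlam0.le (Real.exp_pos _).le
        _ = 2 * Real.exp (-(A₃ * r ^ 3) + r / 2 + r / 8) := by rw [Real.exp_add, Real.exp_add]; ring
        _ ≤ 2 * Real.exp (-r) := by
            apply mul_le_mul_of_nonneg_left (Real.exp_le_exp.2 _) (by norm_num); linarith only [hA3r]
    have h1 := exp_neg_le_factorial_div_pow hr0
    rw [show r ^ 10 = L ^ 2 by rw [show r ^ 10 = (r ^ 5) ^ 2 by ring, hr5]] at h1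
    have h3 : 147 * 10 ^ 6 * κ ≤ ε * L := by
      have := hLκ; rw [div_le_iff₀ hε] at this; linarith only [this]
    calc 2 * Real.pi * Real.exp (-(A₃ * r ^ 3)) * (κ * (y : ℝ) ^ (1 / 2 : ℝ)) * Φ * (1 + |lam|)
        = 2 * Real.pi * κ * Φ * (Real.exp (-(A₃ * r ^ 3)) * ((y : ℝ) ^ (1 / 2 : ℝ) * (1 + |lam|))) := by ring
      _ ≤ 2 * 3.1416 * κ * (2 * L) * (2 * Real.exp (-r)) := by
          apply mul_le_mul _ hexp (by positivity) (by positivity)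
          exact mul_le_mul (by nlinarith only [hπ4, hκ]) hΦle hΦ0.le (by positivity)
      _ ≤ 2 * 3.1416 * κ * (2 * L) * (2 * (3628800 / L ^ 2)) := by
          apply mul_le_mul_of_nonneg_left (mul_le_mul_of_nonneg_left h1 (by norm_num)) (by positivity)
      _ = (2 * 3.1416 * 2 * 2 * 3628800) * κ / L := by field_simp
      _ ≤ 5 / 8 * ε := by rw [div_le_iff₀ hL0]; nlinarith only [h3, hκ]
  -- ### T6: `2π C_λ Φ (1+|λ|)/(κ² y) ≤ (5/8) ε`
  have hT6 : 2 * Real.pi * (2 + 6 * (2 * π * |lam|) + 6 * (2 * π * |lam|) ^ 2 + (2 * π * |lam|) ^ 3) /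
      (κ * (y : ℝ) ^ (1 / 2 : ℝ)) ^ 2 * Φ * (1 + |lam|) ≤ 5 / 8 * ε := by
    have hC := decayConst_le hΛ1 hlam
    have hden : (κ * (y : ℝ) ^ (1 / 2 : ℝ)) ^ 2 = κ ^ 2 * y := by rw [mul_pow, hsqy]
    rw [hden]
    -- `Λ⁴ (1+|λ|)... ≤ 2Λ·750Λ³ = 1500 Λ⁴ ≤ 1500 √y`, `Φ ≤ 2L`, `L √y ≤ y/L · ...`
    have h1 : (2 + 6 * (2 * π * |lam|) + 6 * (2 * π * |lam|) ^ 2 + (2 * π * |lam|) ^ 3) * (1 + |lam|) ≤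
        1500 * (y : ℝ) ^ (1 / 2 : ℝ) := by
      calc _ ≤ 750 * Λ ^ 3 * (2 * Λ) := mul_le_mul hC hlam1 hlam0.le (by positivity)
        _ = 1500 * Λ ^ 4 := by ring
        _ ≤ 1500 * (y : ℝ) ^ (1 / 2 : ℝ) := by linarith only [hΛ4]
    have h2 : (y : ℝ) ^ (1 / 2 : ℝ) * (L * L) ≤ (y : ℝ) := by
      calc (y : ℝ) ^ (1 / 2 : ℝ) * (L * L) = (y : ℝ) ^ (1 / 2 : ℝ) * L ^ 2 := by ring
        _ ≤ (y : ℝ) ^ (1 / 2 : ℝ) * (y : ℝ) ^ (1 / 2 : ℝ) := mul_le_mul_of_nonneg_left hL2sq hsqy0.le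
        _ = y := by rw [← sq, hsqy]
    have h3 : 31000 ≤ κ ^ 2 * ε * L := by
      have := hLκ2; rw [div_le_iff₀ (by positivity)] at this; linarith only [this]
    rw [show 2 * Real.pi * (2 + 6 * (2 * π * |lam|) + 6 * (2 * π * |lam|) ^ 2 + (2 * π * |lam|) ^ 3) / (κ ^ 2 * ↑y) * Φ *
        (1 + |lam|) = 2 * Real.pi * Φ * ((2 + 6 * (2 * π * |lam|) + 6 * (2 * π * |lam|) ^ 2 + (2 * π * |lam|) ^ 3) *
        (1 + |lam|)) / (κ ^ 2 * y) by ring]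
    rw [div_le_iff₀ (by positivity)]
    calc 2 * Real.pi * Φ * ((2 + 6 * (2 * π * |lam|) + 6 * (2 * π * |lam|) ^ 2 + (2 * π * |lam|) ^ 3) * (1 + |lam|))
        ≤ 2 * 3.1416 * (2 * L) * (1500 * (y : ℝ) ^ (1 / 2 : ℝ)) := by
          apply mul_le_mul (mul_le_mul (by nlinarith only [hπ4]) hΦle hΦ0.le (by positivity)) h1 (by positivity)
            (by positivity)
      _ = (2 * 3.1416 * 2 * 1500) * ((y : ℝ) ^ (1 / 2 : ℝ) * L) := by ring
      _ ≤ 5 / 8 * ε * (κ ^ 2 * y) := by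
          -- `18850 √y L ≤ (5/8) ε κ² y` iff `18850 L ≤ (5/8) ε κ² √y`, and `√y ≥ L²`, `ε κ² L ≥ 31000`
          have h4 : (2 * 3.1416 * 2 * 1500) * ((y : ℝ) ^ (1 / 2 : ℝ) * L) * L ≤ 5 / 8 * ε * (κ ^ 2 * y) * L := by
            calc (2 * 3.1416 * 2 * 1500) * ((y : ℝ) ^ (1 / 2 : ℝ) * L) * L
                = (2 * 3.1416 * 2 * 1500) * ((y : ℝ) ^ (1 / 2 : ℝ) * (L * L)) := by ring
              _ ≤ (2 * 3.1416 * 2 * 1500) * y := by nlinarith only [h2]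
              _ ≤ 5 / 8 * ε * (κ ^ 2 * y) * L := by nlinarith only [h3, hy0]
          exact le_of_mul_le_mul_right h4 hL0
  -- ### combine
  have hsum := add_le_add (add_le_add (add_le_add hT1 hT23) hT4) (add_le_add hT5 hT6)
  linarith only [hsum]

end TwistedWeight

end Literature.NumberTheory.Sieve

end
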